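import Literature.AlgebraicGeometry.HodgeTheory.WeilClassesFieldAllOrNothing
import Literature.AlgebraicGeometry.HodgeTheory.MotivatedClassesRationalSpan
import Literature.AlgebraicGeometry.Deligne1982.WeilTypeCMHodgeGroupLeSU
import HarnessLib

/-!
# «All or nothing», complexified: `W_F ⊗ ℂ` meets every `F^*`-stable RATIONAL subspace in `0` or in all of
# `W_F ⊗ ℂ`; the sums `Dᵐ ⊗ ℂ ⊕ W_F ⊗ ℂ ⊆ Bᵐ ⊗ ℂ` are direct in the exceptional case
# (Moonen–Zarhin 1998 §1, section «all or nothing», read over `ℂ`)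

Layer `Literature/AlgebraicGeometry/HodgeTheory`, theorem-only sequel of `WeilClassesFieldAllOrNothing` (the RATIONAL
reading of Moonen–Zarhin's «either all elements of `W_F` are Hodge classes, or `0 ∈ W_F` is the only Hodge class, and in
the first case, either `W_F ∖ {0}` consists entirely of exceptional classes, or none of the classes in `W_F` is
exceptional»: for an `F^*`-stable complex subspace `M`, ONE non-zero rational class of `W_F ⊗ ℂ` in `M` forces
`W_F ⊗ ℂ ≤ M`).  In print `W_F ⊂ H^r(X, ℚ)` and `D^•(X)`, `B^•(X)` are `ℚ`-vector spaces, and the dichotomy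
«`W_F ∩ D^•(X) = 0` or `W_F ⊆ D^•(X)`» complexifies to «`(W_F ⊗ ℂ) ∩ (D ⊗ ℂ) = 0` or `W_F ⊗ ℂ ⊆ D ⊗ ℂ`», because
`(U ⊗ ℂ) ∩ (M ⊗ ℂ) = (U ∩ M) ⊗ ℂ` for `ℚ`-subspaces `U`, `M`.  On the tree's carriers the complex spaces
`weilClassesField`, `divisorClassesSpan`, `hodgeClassSpan`, `algebraicClasses` are DEFINED over `ℂ`, each is proved to be
spanned by its rational classes, and the descent `(U ⊗ ℂ) ∩ (M ⊗ ℂ) = (U ∩ M) ⊗ ℂ` becomes the theorem of §1.  THIS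
file proves it and draws the complexified dichotomies and the dimension count they imply.  Everything is proved; no
definition, no named fact.

PRINTED SOURCES.  B. J. J. Moonen – Yu. G. Zarhin, *Weil classes on abelian varieties*, J. reine angew. Math. 496
(1998) 83–92 = arXiv:alg-geom/9612017 (held text `paper:arxiv-alg-geom_9612017`, chunk p0001): Introduction, «`W_F` … can
be identified in a natural manner with a subspace of `H^r(X,ℚ)` … We call `W_F` the space of Weil classes with respect
to `F`»; §1 section «all or nothing» (lines 57–66, quoted in `WeilClassesFieldAllOrNothing`); and, for an imaginary
quadratic `k` with `n_σ = n_{σ′} = 2` on a fourfold, «a 2-dimensional subspace `W_k ⊆ H⁴(X,ℚ)` which … consists of Hodge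
classes.  Moreover … for “generic” abelian fourfolds … the space `W_k` consists of exceptional Hodge classes» (lines
20–31).  B. van Geemen, LNM 1594 (1994), 2.1 «`Bᵖ(X) := H²ᵖ(X, ℚ) ∩ H^{p,p}`», 2.4–2.5 «`Dᵖ ⊂ Bᵖ` … An exceptional Hodge
class is an element of `Bᵖ` which is not in `Dᵖ`», 6.7 «`Bᵖ(X) ⊗_ℚ ℂ`», Thm. 6.12 «`Bⁿ(X) = Dⁿ(X) ⊕ ⋀^{2n}_K H¹(X, ℚ)`»
(the quadratic case of §5 below, the tree's `divisorClassesSpan_inf_weilClassesOf_eq_bot` for simple fourfolds).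

WHAT IS PROVED.  `A` a complex abelian variety, `φ : A ⟶ A`, `P(φ) = 0` for `P ∈ ℤ[T]` monic irreducible of degree `e`
(`F = ℚ(φ)`), `e · r = 2 dim A`, `W = W_F ⊗ ℂ = weilClassesField A φ P r`.
* §1 DESCENT OF INTERSECTIONS (pure linear algebra of rational classes, any space `Y`):
  **`inf_le_span_isRationalClass_of_le_span`** — if the complex subspaces `U`, `M ⊆ Hᵏ(Y; ℂ)` are each spanned by their
  rational classes, so is `U ⊓ M` (a class of `U ⊓ M` is the complex combination of its rational shadows
  `Σ φ(gⱼ) uⱼ = Σ φ(hⱼ) wⱼ`, `φ ∈ Hom_ℚ(ℂ, ℚ)`, which lie in `U ⊓ M`: `sum_smul_mem_span_dual`,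
  `sum_dual_smul_eq_zero_of_isRationalClass`).
* §2 **`weilClassesField_inf_eq_bot_or_le`** — for every complex subspace `M ⊆ Hʳ(A(ℂ); ℂ)` spanned by its rational
  classes and stable under the test pull-backs `(x·𝟙 + φ)^*` («`F^*` acts on …»): `W ⊓ M = ⊥` or `W ≤ M`
  (§1 + the one-class lemma `weilClassesField_le_of_isRationalClass_of_ne_zero`).
* §3 `Dᵐ ⊗ ℂ`: `divisorClassesSpan_le_span_isRationalClass` and **`weilClassesField_inf_divisorClassesSpan_eq_bot_or_le`**
  — «either `W_F ∖ {0}` consists entirely of exceptional classes, or none is exceptional», over `ℂ`: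
  `W ⊓ (Dᵐ ⊗ ℂ) = ⊥` or `W ≤ Dᵐ ⊗ ℂ`; `weilClassesField_inf_divisorClassesSpan_eq_bot_of_not_mem` (one exceptional Weil
  class ⟹ the intersection is `0`).
* §4 `Bᵐ ⊗ ℂ = hodgeClassSpan`: `weilClassesField_le_hodgeClassSpan_iff` (`W ≤ Bᵐ ⊗ ℂ` iff every class of `W` is of
  type `(m, m)`; iff `n_ρ = n_ρ̄` at every root is the tree's
  `Deligne1982.weilClassesField_le_hodgeClassSpan_iff_forall_eigenMultiplicity_eq` — the Criterion),
  **`weilClassesField_inf_hodgeClassSpan_eq_bot_or_le`** («either all elements of `W_F` are Hodge classes, or `0 ∈ W_F`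
  is the only Hodge class», over `ℂ`:
  `W ⊓ (Bᵐ ⊗ ℂ) = ⊥` or `W ≤ Bᵐ ⊗ ℂ`), `weilClassesField_inf_hodgeClassSpan_eq_bot_of_unbalanced`.
* §5 `algebraicClasses`: **`weilClassesField_inf_algebraicClasses_eq_bot_or_le`**.
* §6 THE DIMENSION COUNT: `divisorClassesSpan_le_hodgeClassSpan_of_isSmoothProjective` (`Dᵐ ⊗ ℂ ≤ Bᵐ ⊗ ℂ`),
  `finrank_divisorClassesSpan_sup_weilClassesField` (in the exceptional case `dim (Dᵐ ⊗ ℂ ⊔ W) = dim (Dᵐ ⊗ ℂ) + e`) and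
  **`natDegree_le_finrank_hodgeClassSpan_sub_finrank_divisorClassesSpan`**: if `W_F` consists of Hodge classes and ONE of
  them is exceptional, then `dim_ℂ (Bᵐ ⊗ ℂ) − dim_ℂ (Dᵐ ⊗ ℂ) ≥ [F:ℚ] = e` — the `[F:ℚ]`-dimensional space `W_F` of print
  («a 2-dimensional subspace `W_k ⊆ H⁴(X,ℚ)` … consists of exceptional Hodge classes» for `[k:ℚ] = 2`; van Geemen 6.12
  `Bⁿ = Dⁿ ⊕ W_K`) contributes `[F:ℚ]` independent exceptional classes to `Bᵐ/Dᵐ`.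

Honesty clause: dichotomies, direct sums and a lower bound only — no Weil class is proved Hodge, algebraic or
decomposable outright; `e ≤ dim B − dim D` is conditional on the printed hypotheses (`W_F` Hodge, one exceptional class).
No `sorry`; axioms `propext`, `Classical.choice`, `Quot.sound`.

## References
* [MoonenZarhin1998WeilClasses] B. J. J. Moonen, Yu. G. Zarhin, *Weil classes on abelian varieties*, J. reine angew.
  Math. 496 (1998) 83–92 = arXiv:alg-geom/9612017, Introduction (W_F ⊂ H^r(X,ℚ); W_k of exceptional classes, lines 20–31)
  and §1 section «all or nothing» (chunk p0001, lines 57–66).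
* [vanGeemen1994HodgeAV] B. van Geemen, *An introduction to the Hodge conjecture for abelian varieties*, LNM 1594
  (1994), 2.1, 2.4–2.5, 6.7, Thm. 6.12.
* [Deligne1982HodgeCycles] P. Deligne (notes by J. S. Milne), LNM 900 (1982), §4 (4.4) (`dim_E ⋀^d_E H¹ = 1`).
* [HatcherAT2002] A. Hatcher, *Algebraic Topology* (2002), §3.1 Thm. 3.2 and p. 198 (universal coefficients: rational
  classes, `Hᵏ(X;ℚ) ⊗ ℂ = Hᵏ(X;ℂ)`).
* [GrothendieckTopology1969] A. Grothendieck, *Hodge's general conjecture is false for trivial reasons*, Topology 8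
  (1969), §1 p. 299 (algebraic classes with coefficients).
-/

noncomputable section

open CategoryTheory Polynomial Module

universe u

namespace Literature.AlgebraicGeometry.HodgeTheory

open Literature.AlgebraicGeometry.Motives (AbelianVariety IsSmoothProjective)
open Literature.AlgebraicGeometry.Deligne1982 (finrank_weilClassesField_eq_natDegree)
open Literature.AlgebraicGeometry.VanGeemen1994 (hodgeClassSpan)
open Literature.AlgebraicTopology.SingularHomology
open Literature.Barriers.HodgeConjecture (divisorClassesSpan divisorMonomials)

section HodgeTheory

/-! ### §1 Descent of intersections: `(U ⊗ ℂ) ∩ (M ⊗ ℂ) = (U ∩ M) ⊗ ℂ` for rational subspaces -/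

section Descent

variable {Y : Type u} [TopologicalSpace Y] {k : ℕ}

/-- **The intersection of two complex subspaces spanned by rational classes is spanned by rational classes**
(`(U ⊗ ℂ) ∩ (M ⊗ ℂ) = (U ∩ M) ⊗ ℂ` for `ℚ`-subspaces of `Hᵏ(Y; ℚ)`, on the carrier `Hᵏ(Y; ℂ)` with its rational classes):
if `U ≤ span_ℂ {c ∈ U | c rational}` and `M ≤ span_ℂ {c ∈ M | c rational}` then
`U ⊓ M ≤ span_ℂ {c ∈ U ⊓ M | c rational}`.  Proof: write `c ∈ U ⊓ M` as `Σ gⱼ uⱼ` (`uⱼ ∈ U` rational) and as `Σ hⱼ wⱼ`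
(`wⱼ ∈ M` rational); the complex relation `Σ gⱼ uⱼ − Σ hⱼ wⱼ = 0` among rational classes has all its rational shadows
(`sum_dual_smul_eq_zero_of_isRationalClass`), so for every `ℚ`-linear `φ : ℂ → ℚ` the rational class
`Σ φ(gⱼ) uⱼ = Σ φ(hⱼ) wⱼ` lies in `U ⊓ M`; and `c` is a complex combination of these shadows (`sum_smul_mem_span_dual`).
[cite: HatcherAT2002, §3.1 Thm. 3.2 and p. 198] [cite: vanGeemen1994HodgeAV, 6.7 (Bᵖ ⊗_ℚ ℂ)] -/
theorem inf_le_span_isRationalClass_of_le_span {U M : Submodule ℂ (singularCohomology ℂ ℂ Y k)}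
    (hU : U ≤ Submodule.span ℂ {c | c ∈ U ∧ IsRationalClass c})
    (hM : M ≤ Submodule.span ℂ {c | c ∈ M ∧ IsRationalClass c}) :
    U ⊓ M ≤ Submodule.span ℂ {c | c ∈ U ⊓ M ∧ IsRationalClass c} := by
  classical
  rintro c ⟨hcU, hcM⟩
  obtain ⟨m, g, u, hcu⟩ := Submodule.mem_span_set'.1 (hU hcU)
  obtain ⟨m', h, w, hcw⟩ := Submodule.mem_span_set'.1 (hM hcM)
  -- the combined rational family and the relation `Σ gⱼ uⱼ − Σ hⱼ wⱼ = c − c = 0`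
  let b : Fin m ⊕ Fin m' → singularCohomology ℂ ℂ Y k :=
    Sum.elim (fun j => (u j : singularCohomology ℂ ℂ Y k)) (fun j => (w j : singularCohomology ℂ ℂ Y k))
  let a : Fin m ⊕ Fin m' → ℂ := Sum.elim g (fun j => -h j)
  have hb : ∀ i, IsRationalClass (b i) := by
    rintro (j | j)
    · exact (u j).2.2
    · exact (w j).2.2
  have hab : ∑ i, a i • b i = 0 := by
    rw [Fintype.sum_sum_type]
    simp only [a, b, Sum.elim_inl, Sum.elim_inr, neg_smul, Finset.sum_neg_distrib, hcu, hcw, add_neg_cancel]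
  -- every rational shadow of `c = Σ gⱼ uⱼ` is a rational class of `U ⊓ M`
  have hshadow : ∀ ψ : ℂ →ₗ[ℚ] ℚ,
      ∑ j, ((ψ (g j) : ℚ) : ℂ) • (u j : singularCohomology ℂ ℂ Y k) ∈
        {c | c ∈ U ⊓ M ∧ IsRationalClass c} := by
    intro ψ
    have h0 := sum_dual_smul_eq_zero_of_isRationalClass hb hab ψ
    rw [Fintype.sum_sum_type] at h0
    simp only [a, b, Sum.elim_inl, Sum.elim_inr, map_neg, Rat.cast_neg, neg_smul, Finset.sum_neg_distrib,
      add_neg_eq_zero] at h0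
    refine ⟨⟨Submodule.sum_mem _ fun j _ => Submodule.smul_mem _ _ (u j).2.1, ?_⟩,
      IsRationalClass.sum_smul Finset.univ (fun j => (u j).2.2) (fun j => ψ (g j))⟩
    rw [h0]
    exact Submodule.sum_mem _ fun j _ => Submodule.smul_mem _ _ (w j).2.1
  rw [← hcu]
  refine Submodule.span_mono ?_ (sum_smul_mem_span_dual g (fun j => (u j : singularCohomology ℂ ℂ Y k)))
  rintro _ ⟨ψ, rfl⟩
  exact hshadow ψ

/-- If a complex subspace spanned by rational classes has no non-zero rational class in common with another such
subspace, the two meet in `0`. [cite: HatcherAT2002, §3.1 Thm. 3.2 and p. 198] -/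
theorem inf_eq_bot_of_forall_isRationalClass_eq_zero {U M : Submodule ℂ (singularCohomology ℂ ℂ Y k)}
    (hU : U ≤ Submodule.span ℂ {c | c ∈ U ∧ IsRationalClass c})
    (hM : M ≤ Submodule.span ℂ {c | c ∈ M ∧ IsRationalClass c})
    (h : ∀ c ∈ U, c ∈ M → IsRationalClass c → c = 0) : U ⊓ M = ⊥ := by
  rw [eq_bot_iff]
  refine le_trans (inf_le_span_isRationalClass_of_le_span hU hM) ?_
  rw [Submodule.span_le]
  rintro c ⟨⟨hcU, hcM⟩, hcQ⟩
  simp [h c hcU hcM hcQ]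

end Descent

variable {A : AbelianVariety ℂ} {φ : A ⟶ A} {P : Polynomial ℤ} {e r : ℕ}

/-! ### §2 `W_F ⊗ ℂ` meets an `F^*`-stable rational subspace in `0` or in all of `W_F ⊗ ℂ` -/

section General

/-- **COMPLEXIFIED «ALL OR NOTHING»**: for `P ∈ ℤ[T]` irreducible of degree `e`, `P(φ) = 0`, `r ≠ 0`, `e · r = 2 dim A`,
and a complex subspace `M ⊆ Hʳ(A(ℂ); ℂ)` SPANNED BY ITS RATIONAL CLASSES and stable under the test pull-backs
`(x·𝟙 + φ)^*`, `x ∈ ℕ`: either `W_F ⊗ ℂ ∩ M = 0` or `W_F ⊗ ℂ ⊆ M`.  (`W_F ⊗ ℂ` is spanned by its rational classes,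
`weilClassesField_le_span_isRationalClass`; so is `W_F ⊗ ℂ ∩ M` by §1; a non-zero rational class in it makes
`W_F ⊗ ℂ ≤ M` by the one-class lemma.) [cite: MoonenZarhin1998WeilClasses, §1 section «all or nothing» (chunk p0001,
lines 57–66)] [cite: HatcherAT2002, §3.1 p. 198] -/
theorem weilClassesField_inf_eq_bot_or_le (hPe : P.natDegree = e) (hPirr : Irreducible (P.map (Int.castRingHom ℚ)))
    (hφ : Polynomial.eval₂ (Int.castRingHom (CategoryTheory.End A)) (φ : CategoryTheory.End A) P = 0)
    (her : e * r = 2 * A.dim) (hr : r ≠ 0) {M : Submodule ℂ (complexBetti A.X r)}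
    (hMQ : M ≤ Submodule.span ℂ {c | c ∈ M ∧ IsRationalClass c})
    (hM : ∀ x : ℕ, ∀ c ∈ M, (complexBetti.map (x • 𝟙 A + 1 • φ).hom.hom.hom r).hom c ∈ M) :
    weilClassesField A φ P r ⊓ M = ⊥ ∨ weilClassesField A φ P r ≤ M := by
  by_cases h : ∃ γ ∈ weilClassesField A φ P r, γ ∈ M ∧ IsRationalClass γ ∧ γ ≠ 0
  · obtain ⟨γ, hγW, hγM, hγQ, hγ0⟩ := h
    exact Or.inr (weilClassesField_le_of_isRationalClass_of_ne_zero hPe hPirr hφ her hr hM hγW hγQ hγ0 hγM)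
  · push Not at h
    exact Or.inl (inf_eq_bot_of_forall_isRationalClass_eq_zero
      (weilClassesField_le_span_isRationalClass hPirr hφ r) hMQ h)

/-- The same for a rational subspace stable under pull-back along EVERY endomorphism of `A`.
[cite: MoonenZarhin1998WeilClasses, §1 section «all or nothing» (chunk p0001, lines 57–66)] -/
theorem weilClassesField_inf_eq_bot_or_le_of_forall_map_mem (hPe : P.natDegree = e)
    (hPirr : Irreducible (P.map (Int.castRingHom ℚ)))
    (hφ : Polynomial.eval₂ (Int.castRingHom (CategoryTheory.End A)) (φ : CategoryTheory.End A) P = 0)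
    (her : e * r = 2 * A.dim) (hr : r ≠ 0) {M : Submodule ℂ (complexBetti A.X r)}
    (hMQ : M ≤ Submodule.span ℂ {c | c ∈ M ∧ IsRationalClass c})
    (hM : ∀ g : A ⟶ A, ∀ c ∈ M, (complexBetti.map g.hom.hom.hom r).hom c ∈ M) :
    weilClassesField A φ P r ⊓ M = ⊥ ∨ weilClassesField A φ P r ≤ M :=
  weilClassesField_inf_eq_bot_or_le hPe hPirr hφ her hr hMQ (fun _ => hM _)

/-- **`W_F ⊗ ℂ ∩ M` is spanned by its rational classes** for every complex subspace `M` spanned by its rational classes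
(no stability needed). [cite: HatcherAT2002, §3.1 p. 198] [cite: MoonenZarhin1998WeilClasses, Introduction (W_F ⊂ H^r(X,ℚ))] -/
theorem weilClassesField_inf_le_span_isRationalClass (hPirr : Irreducible (P.map (Int.castRingHom ℚ)))
    (hφ : Polynomial.eval₂ (Int.castRingHom (CategoryTheory.End A)) (φ : CategoryTheory.End A) P = 0)
    {M : Submodule ℂ (complexBetti A.X r)} (hMQ : M ≤ Submodule.span ℂ {c | c ∈ M ∧ IsRationalClass c}) :
    weilClassesField A φ P r ⊓ M ≤
      Submodule.span ℂ {c | c ∈ weilClassesField A φ P r ⊓ M ∧ IsRationalClass c} :=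
  inf_le_span_isRationalClass_of_le_span (weilClassesField_le_span_isRationalClass hPirr hφ r) hMQ

end General

/-! ### §3 The complexified divisor ring `Dᵐ ⊗ ℂ` -/

section Divisor

variable {m : ℕ}

/-- `Dᵐ ⊗ ℂ` is spanned by its rational classes (it is the span of the divisor monomials, which are rational:
`isRationalClass_of_mem_divisorMonomials`). [cite: vanGeemen1994HodgeAV, §2.4] [cite: HatcherAT2002, §3.2] -/
theorem divisorClassesSpan_le_span_isRationalClass {N : ℕ} {X : Motives.SchemeOver ℂ} (m : ℕ) :
    divisorClassesSpan X N m ≤ Submodule.span ℂ {c | c ∈ divisorClassesSpan X N m ∧ IsRationalClass c} :=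
  Submodule.span_mono fun _ hc => ⟨Submodule.subset_span hc, isRationalClass_of_mem_divisorMonomials hc⟩

/-- **«Either `W_F ∖ {0}` consists entirely of exceptional classes, or none of the classes in `W_F` is exceptional»,
OVER `ℂ`**: for `P ∈ ℤ[T]` irreducible of degree `e`, `P(φ) = 0`, `e · 2m = 2 dim A`, `m ≠ 0`:
`W_F ⊗ ℂ ∩ Dᵐ ⊗ ℂ = 0` or `W_F ⊗ ℂ ⊆ Dᵐ ⊗ ℂ`. [cite: MoonenZarhin1998WeilClasses, §1 section «all or nothing» (chunk
p0001, lines 57–66)] [cite: vanGeemen1994HodgeAV, 2.4–2.5 and Thm. 6.12] -/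
theorem weilClassesField_inf_divisorClassesSpan_eq_bot_or_le (hPe : P.natDegree = e)
    (hPirr : Irreducible (P.map (Int.castRingHom ℚ)))
    (hφ : Polynomial.eval₂ (Int.castRingHom (CategoryTheory.End A)) (φ : CategoryTheory.End A) P = 0)
    (her : e * (2 * m) = 2 * A.dim) (hm : m ≠ 0) :
    weilClassesField A φ P (2 * m) ⊓ divisorClassesSpan A.X A.dim m = ⊥ ∨
      weilClassesField A φ P (2 * m) ≤ divisorClassesSpan A.X A.dim m :=
  weilClassesField_inf_eq_bot_or_le_of_forall_map_mem hPe hPirr hφ her (by omega)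
    (divisorClassesSpan_le_span_isRationalClass m) (fun g _ hc => AbelianVariety.map_mem_divisorClassesSpan g hc)

/-- **One exceptional Weil class ⟹ `W_F ⊗ ℂ ∩ Dᵐ ⊗ ℂ = 0`.** [cite: MoonenZarhin1998WeilClasses, §1 section «all or
nothing» (chunk p0001, lines 57–66)] [cite: vanGeemen1994HodgeAV, Thm. 6.12] -/
theorem weilClassesField_inf_divisorClassesSpan_eq_bot_of_not_mem (hPe : P.natDegree = e)
    (hPirr : Irreducible (P.map (Int.castRingHom ℚ)))
    (hφ : Polynomial.eval₂ (Int.castRingHom (CategoryTheory.End A)) (φ : CategoryTheory.End A) P = 0)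
    (her : e * (2 * m) = 2 * A.dim) (hm : m ≠ 0) {δ : complexBetti A.X (2 * m)}
    (hδW : δ ∈ weilClassesField A φ P (2 * m)) (hδD : δ ∉ divisorClassesSpan A.X A.dim m) :
    weilClassesField A φ P (2 * m) ⊓ divisorClassesSpan A.X A.dim m = ⊥ := by
  rcases weilClassesField_inf_divisorClassesSpan_eq_bot_or_le hPe hPirr hφ her hm with h | h
  · exact h
  · exact absurd (h hδW) hδD

end Divisor

/-! ### §4 `Bᵐ ⊗ ℂ = hodgeClassSpan`: the complexified Hodge dichotomy -/

section HodgeSpan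

variable {m : ℕ}

/-- `Bᵖ ⊗ ℂ` is spanned by its rational classes (by definition it is the span of the rational `(p,p)`-classes).
[cite: vanGeemen1994HodgeAV, 2.1 and 6.7] -/
theorem hodgeClassSpan_le_span_isRationalClass {N : ℕ} {X : Motives.SchemeOver ℂ} (p : ℕ) :
    hodgeClassSpan N X p ≤ Submodule.span ℂ {c | c ∈ hodgeClassSpan N X p ∧ IsRationalClass c} :=
  Submodule.span_mono fun _ hc => ⟨Submodule.subset_span hc, hc.1⟩

/-- Every class of `Bᵖ ⊗ ℂ` is of Hodge type `(p, p)` (`X` smooth projective). [cite: vanGeemen1994HodgeAV, 2.1 and 6.7]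
[cite: VoisinHodgeI2002, §7.1.1] -/
theorem isOfHodgeType_of_mem_hodgeClassSpan_smoothProjective {N : ℕ} {X : Motives.SchemeOver ℂ}
    (hX : IsSmoothProjective N X) {p : ℕ} {c : complexBetti X (2 * p)} (hc : c ∈ hodgeClassSpan N X p) : IsOfHodgeType N X (2 * p) p p c := by
  obtain ⟨Mdl⟩ := nonempty_hodgeModel_holds hX
  induction hc using Submodule.span_induction with
  | mem x hx => exact hx.2
  | zero => exact IsOfHodgeType.zero Mdl _ _ _
  | add a b _ _ ha hb => exact ha.add hX hb
  | smul t a _ ha => exact ha.smul t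

/-- `f^*(Bᵖ(B) ⊗ ℂ) ⊆ Bᵖ(A) ⊗ ℂ` for a homomorphism of complex abelian varieties (element form of `hodgeClassSpan_map_le`).
[cite: vanGeemen1994HodgeAV, §3.6 (p. 236)] -/
theorem AbelianVariety.map_mem_hodgeClassSpan {B : AbelianVariety ℂ} (f : A ⟶ B) {p : ℕ}
    {c : complexBetti B.X (2 * p)} (hc : c ∈ hodgeClassSpan B.dim B.X p) :
    (complexBetti.map f.hom.hom.hom (2 * p)).hom c ∈ hodgeClassSpan A.dim A.X p :=
  hodgeClassSpan_map_le (Motives.AbelianVariety.isSmoothProjective_holds (A := A))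
    (Motives.AbelianVariety.isSmoothProjective_holds (A := B)) f.hom.hom.hom p ⟨c, hc, rfl⟩

/-- **`W_F ⊗ ℂ ⊆ Bᵐ ⊗ ℂ` iff every class of `W_F ⊗ ℂ` is of type `(m, m)`** (`P` irreducible, `P(φ) = 0`; ⟸ because
`W_F ⊗ ℂ` is spanned by its rational classes). [cite: vanGeemen1994HodgeAV, 2.1] [cite: MoonenZarhin1998WeilClasses,
Introduction (W_F ⊂ H^r(X,ℚ); chunk p0001)] -/
theorem weilClassesField_le_hodgeClassSpan_iff (hPirr : Irreducible (P.map (Int.castRingHom ℚ)))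
    (hφ : Polynomial.eval₂ (Int.castRingHom (CategoryTheory.End A)) (φ : CategoryTheory.End A) P = 0) :
    weilClassesField A φ P (2 * m) ≤ hodgeClassSpan A.dim A.X m ↔
      ∀ c ∈ weilClassesField A φ P (2 * m), IsOfHodgeType A.dim A.X (2 * m) m m c := by
  have hX : IsSmoothProjective A.dim A.X := Motives.AbelianVariety.isSmoothProjective_holds (A := A)
  refine ⟨fun h c hc => isOfHodgeType_of_mem_hodgeClassSpan_smoothProjective hX (h hc), fun h => ?_⟩
  rw [weilClassesField_eq_span_isRationalClass hPirr hφ (2 * m), Submodule.span_le]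
  rintro c ⟨hcQ, hcW⟩
  exact Submodule.subset_span ⟨hcQ, h c hcW⟩

/-- **«Either all elements of `W_F` are Hodge classes, or `0 ∈ W_F` is the only Hodge class», OVER `ℂ`**:
`W_F ⊗ ℂ ∩ Bᵐ ⊗ ℂ = 0` or `W_F ⊗ ℂ ⊆ Bᵐ ⊗ ℂ` (`P` irreducible of degree `e`, `P(φ) = 0`, `e · 2m = 2 dim A`, `m ≠ 0`).
[cite: MoonenZarhin1998WeilClasses, §1 section «all or nothing» (chunk p0001, lines 57–66)] [cite: vanGeemen1994HodgeAV,
2.1 and 6.7] -/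
theorem weilClassesField_inf_hodgeClassSpan_eq_bot_or_le (hPe : P.natDegree = e)
    (hPirr : Irreducible (P.map (Int.castRingHom ℚ)))
    (hφ : Polynomial.eval₂ (Int.castRingHom (CategoryTheory.End A)) (φ : CategoryTheory.End A) P = 0)
    (her : e * (2 * m) = 2 * A.dim) (hm : m ≠ 0) :
    weilClassesField A φ P (2 * m) ⊓ hodgeClassSpan A.dim A.X m = ⊥ ∨
      weilClassesField A φ P (2 * m) ≤ hodgeClassSpan A.dim A.X m :=
  weilClassesField_inf_eq_bot_or_le_of_forall_map_mem hPe hPirr hφ her (by omega)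
    (hodgeClassSpan_le_span_isRationalClass m) (fun g _ hc => AbelianVariety.map_mem_hodgeClassSpan g hc)

/-- **Unbalanced multiplicities ⟹ `W_F ⊗ ℂ ∩ Bᵐ ⊗ ℂ = 0`**: if `n_ρ ≠ n_ρ̄` at some root (`P` monic irreducible of
degree `e`, `P(φ) = 0`, `e · 2m = 2 dim A`, `m ≠ 0`), the space of Weil classes meets the complexified space of Hodge
classes trivially — the complexification of «the zero class is the only Hodge class in `W_F`».
[cite: MoonenZarhin1998WeilClasses, §1 (Criterion, second clause; chunk p0001)] -/
theorem weilClassesField_inf_hodgeClassSpan_eq_bot_of_unbalanced (hPm : P.Monic) (hPe : P.natDegree = e)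
    (hPirr : Irreducible (P.map (Int.castRingHom ℚ)))
    (hφ : Polynomial.eval₂ (Int.castRingHom (CategoryTheory.End A)) (φ : CategoryTheory.End A) P = 0)
    (her : e * (2 * m) = 2 * A.dim) (hm : m ≠ 0)
    (hunb : ∃ ρ : ℂ, Polynomial.eval₂ (Int.castRingHom ℂ) ρ P = 0 ∧
      eigenMultiplicity A φ ρ ≠ eigenMultiplicity A φ (starRingEnd ℂ ρ)) :
    weilClassesField A φ P (2 * m) ⊓ hodgeClassSpan A.dim A.X m = ⊥ := by
  rcases weilClassesField_inf_hodgeClassSpan_eq_bot_or_le hPe hPirr hφ her hm with h | h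
  · exact h
  · obtain ⟨ρ, hρ, hne⟩ := hunb
    exact absurd ((Deligne1982.weilClassesField_le_hodgeClassSpan_iff_forall_eigenMultiplicity_eq hPm hPe hPirr hφ
      her).1 h ρ hρ) hne

end HodgeSpan

/-! ### §5 Algebraic classes -/

section Algebraic

variable {m : ℕ}

/-- **`W_F ⊗ ℂ ∩ (algebraic classes) = 0` or `W_F ⊗ ℂ ⊆ (algebraic classes)`** (`P` irreducible of degree `e`,
`P(φ) = 0`, `e · 2m = 2 dim A`, `m ≠ 0`): the `ℂ`-span of the cycle classes is spanned by its rational classes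
(`algebraicClasses_le_span_isRationalClass`) and stable under pull-back along endomorphisms
(`map_mem_algebraicClasses_of_abelianVariety`). [cite: MoonenZarhin1998WeilClasses, §1 section «all or nothing» (chunk
p0001, lines 57–66)] [cite: GrothendieckTopology1969, §1 p. 299] [cite: Markman2025SurveySecant, §4 (p. 9)] -/
theorem weilClassesField_inf_algebraicClasses_eq_bot_or_le (hPe : P.natDegree = e)
    (hPirr : Irreducible (P.map (Int.castRingHom ℚ)))
    (hφ : Polynomial.eval₂ (Int.castRingHom (CategoryTheory.End A)) (φ : CategoryTheory.End A) P = 0)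
    (her : e * (2 * m) = 2 * A.dim) (hm : m ≠ 0) :
    weilClassesField A φ P (2 * m) ⊓ algebraicClasses A.X m = ⊥ ∨
      weilClassesField A φ P (2 * m) ≤ algebraicClasses A.X m := by
  have hX : IsSmoothProjective A.dim A.X := Motives.AbelianVariety.isSmoothProjective_holds (A := A)
  refine weilClassesField_inf_eq_bot_or_le_of_forall_map_mem hPe hPirr hφ her (by omega) ?_
    (fun g _ hc => map_mem_algebraicClasses_of_abelianVariety hX A g.hom.hom.hom hc)
  intro c hc
  refine Submodule.span_mono (fun x hx => ?_) (algebraicClasses_le_span_isRationalClass hX m hc)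
  exact ⟨hx.2, hx.1⟩

end Algebraic

/-! ### §6 The dimension count: `Dᵐ ⊗ ℂ ⊕ W_F ⊗ ℂ ⊆ Bᵐ ⊗ ℂ` in the exceptional case -/

section Dimension

variable {m : ℕ}

/-- `Dᵖ ⊗ ℂ ≤ Bᵖ ⊗ ℂ` on a smooth projective `X` («`Dᵖ ⊂ Bᵖ`»: divisor monomials are rational `(p,p)`-classes).
[cite: vanGeemen1994HodgeAV, §2.4 (p. 235)] -/
theorem divisorClassesSpan_le_hodgeClassSpan_of_isSmoothProjective {N : ℕ} {X : Motives.SchemeOver ℂ}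
    (hX : IsSmoothProjective N X) (p : ℕ) : divisorClassesSpan X N p ≤ hodgeClassSpan N X p :=
  Submodule.span_le.2 fun _ hc =>
    Submodule.subset_span ⟨isRationalClass_of_mem_divisorMonomials hc, isOfHodgeType_of_mem_divisorMonomials hX hc⟩

/-- **`dim_ℂ (Dᵐ ⊗ ℂ + W_F ⊗ ℂ) = dim_ℂ (Dᵐ ⊗ ℂ) + [F:ℚ]` when one Weil class is exceptional** (`P` irreducible of degree `e`,
`P(φ) = 0`, `e · 2m = 2 dim A`, `m ≠ 0`): the sum is direct (§3) and `dim_ℂ W_F ⊗ ℂ = e`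
(`Deligne1982.finrank_weilClassesField_eq_natDegree`). [cite: MoonenZarhin1998WeilClasses, Introduction (the
1-dimensional F-vector space W_F) and §1] [cite: vanGeemen1994HodgeAV, Thm. 6.12] [cite: Deligne1982HodgeCycles, §4 (4.4)] -/
theorem finrank_divisorClassesSpan_sup_weilClassesField (hPe : P.natDegree = e)
    (hPirr : Irreducible (P.map (Int.castRingHom ℚ)))
    (hφ : Polynomial.eval₂ (Int.castRingHom (CategoryTheory.End A)) (φ : CategoryTheory.End A) P = 0)
    (her : e * (2 * m) = 2 * A.dim) (hm : m ≠ 0) {δ : complexBetti A.X (2 * m)}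
    (hδW : δ ∈ weilClassesField A φ P (2 * m)) (hδD : δ ∉ divisorClassesSpan A.X A.dim m) :
    finrank ℂ ↥(divisorClassesSpan A.X A.dim m ⊔ weilClassesField A φ P (2 * m)) =
      finrank ℂ ↥(divisorClassesSpan A.X A.dim m) + e := by
  have hX : IsSmoothProjective A.dim A.X := Motives.AbelianVariety.isSmoothProjective_holds (A := A)
  haveI := finite_complexBetti_abelianVariety A (2 * m)
  have hbot : divisorClassesSpan A.X A.dim m ⊓ weilClassesField A φ P (2 * m) = ⊥ := by
    rw [inf_comm]
    exact weilClassesField_inf_divisorClassesSpan_eq_bot_of_not_mem hPe hPirr hφ her hm hδW hδD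
  have hsum := Submodule.finrank_sup_add_finrank_inf_eq (divisorClassesSpan A.X A.dim m)
    (weilClassesField A φ P (2 * m))
  rw [hbot, finrank_bot, add_zero, finrank_weilClassesField_eq_natDegree hX φ hPe hPirr hφ her (by omega)] at hsum
  exact hsum

/-- **`[F:ℚ]` INDEPENDENT EXCEPTIONAL CLASSES: `e ≤ dim_ℂ (Bᵐ ⊗ ℂ) − dim_ℂ (Dᵐ ⊗ ℂ)`** when `W_F` consists of Hodge
classes (`n_ρ = n_ρ̄` at every root, `P` monic irreducible of degree `e`, `P(φ) = 0`, `e · 2m = 2 dim A`, `m ≠ 0`) and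
ONE Weil class is exceptional: then `Dᵐ ⊗ ℂ ⊕ W_F ⊗ ℂ ⊆ Bᵐ ⊗ ℂ` is direct, with `dim_ℂ W_F ⊗ ℂ = [F:ℚ]` — the space of
print «which … consists of exceptional Hodge classes».  (For `[F:ℚ] = 2` on a simple fourfold this is the tree's
`two_le_finrank_hodgeClassSpan_sub_finrank_divisorClassesSpan_of_isWeilType`, van Geemen 6.12 `Bⁿ = Dⁿ ⊕ W_K`.)
[cite: MoonenZarhin1998WeilClasses, Introduction (W_k consists of exceptional Hodge classes, lines 20–31) and §1 section
«all or nothing»] [cite: vanGeemen1994HodgeAV, 2.4–2.5 and Thm. 6.12] -/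
theorem natDegree_le_finrank_hodgeClassSpan_sub_finrank_divisorClassesSpan (hPm : P.Monic)
    (hPe : P.natDegree = e) (hPirr : Irreducible (P.map (Int.castRingHom ℚ)))
    (hφ : Polynomial.eval₂ (Int.castRingHom (CategoryTheory.End A)) (φ : CategoryTheory.End A) P = 0)
    (her : e * (2 * m) = 2 * A.dim) (hm : m ≠ 0)
    (hbal : ∀ ρ : ℂ, Polynomial.eval₂ (Int.castRingHom ℂ) ρ P = 0 →
      eigenMultiplicity A φ ρ = eigenMultiplicity A φ (starRingEnd ℂ ρ))
    {δ : complexBetti A.X (2 * m)} (hδW : δ ∈ weilClassesField A φ P (2 * m))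
    (hδD : δ ∉ divisorClassesSpan A.X A.dim m) :
    e ≤ finrank ℂ ↥(hodgeClassSpan A.dim A.X m) - finrank ℂ ↥(divisorClassesSpan A.X A.dim m) := by
  have hX : IsSmoothProjective A.dim A.X := Motives.AbelianVariety.isSmoothProjective_holds (A := A)
  haveI := finite_complexBetti_abelianVariety A (2 * m)
  have hle : divisorClassesSpan A.X A.dim m ⊔ weilClassesField A φ P (2 * m) ≤ hodgeClassSpan A.dim A.X m :=
    sup_le (divisorClassesSpan_le_hodgeClassSpan_of_isSmoothProjective hX m)
      ((Deligne1982.weilClassesField_le_hodgeClassSpan_iff_forall_eigenMultiplicity_eq hPm hPe hPirr hφ her).2 hbal)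
  have h := Submodule.finrank_mono hle
  rw [finrank_divisorClassesSpan_sup_weilClassesField hPe hPirr hφ her hm hδW hδD, add_comm] at h
  exact Nat.le_sub_of_add_le h

end Dimension

end HodgeTheory

end Literature.AlgebraicGeometry.HodgeTheory

end
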